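import Literature.MathematicalPhysics.QuantumFieldTheory.Balaban1983to89.B6Eq292MemberTorusV1
import Literature.MathematicalPhysics.QuantumFieldTheory.Balaban1983to89.B6Partition118KLevelTorusBinders
import Literature.MathematicalPhysics.QuantumFieldTheory.Balaban1983to89.B6ScalarChartV1
import Literature.MathematicalPhysics.QuantumFieldTheory.Balaban1983to89.B8Ineq192MultiLevelTorus

/-!
# `Balaban1983to89.B6CubeCoeffSizesV1` — T. Bałaban, *Propagators and renormalization transformations for lattice gauge theories. II*,
# Commun. Math. Phys. **96** (1984) 223–250 [Balaban1984PropagatorsII], p. 247 / (2.92) p. 239 line 1: THE SIZES AND SUPPORTS OF THE COEFFICIENTS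
# `c_e = s(□)·(E_eh_□)`, `c₀ = s(□)·(Δh_□)` OF THE GENUINE MEMBER OF A CUBE ON THE GLOBAL TORUS — *"|∂h_□| ≤ O(1)(ML^jη)^{−1}, |Δh_□| ≤ O(1)M^{−1}(L^jη)^{−2}"*
# read through the window chart: the binders `hcf`, `hcfT`, `hc₀`, `hc₀T` of `…B6Ineq2134KFamKLevelTorusIn.h2134_kFam_torus_in` for p38's `cfC`, `c0C`

statement-level skeleton of published theorems with citation tags; proofs where landed; nothing here is a claim about the Yang–Mills mass gap

PDF held: `paper:balaban1984-cmp96-propagators-rt-ii` (journal page = PDF page + 222): p. 239 [PDF 17] (2.92), p. 247 [PDF 25]; read from the tree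
transcriptions (`…B6Ineq2134Diag`, `…B6Partition118KLevelFineSecond`, `…B6Eq292MemberTorusV1`).  PRINT p. 247: *"|∂h_□| ≤ O(1)(ML^jη)^{−1},
|Δh_□| ≤ O(1)M^{−1}(L^jη)^{−2}"*; the supports of these functions lie in □̃ — OUR PARAPHRASE of p. 239 (ζ_□ *"equal to 1 on a cube containing □ … equal to 0
outside a similar cube"*) and (2.36) p. 229, NOT a printed sentence (v1/v1.1 had this clause inside the quotation marks attributed to p. 247; v1.2 DOCFIX per
ref-4 D-g67-1; Lean content unchanged).

CITATION HEADER (lean-in-tree rule) — WHAT IS REPRODUCED.  Phase-2 file of the `lit-balaban` typed skeleton, seat **p38 gen 27**; owner r03 gen 21's division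
(seat INBOX 2026-08-23T06:11Z/07:03Z: *"remaining per-cube inputs: p38's (a) coefficient sizes hcf/hc₀ (+hcfT/hc₀T)"*).  SKELETON rows **B6.Eq2.92** ×
**B6.Eq2.134** (cells only).  The coefficients of `…B6Eq292MemberTorusV1.hdec_cube` are `cfC e = τ_{−v}ε(s(□)•E_e(ρh^ch_□))`, `c0C = τ_{−v}ε(s(□)•Δ_□(ρh^ch_□))`
(`ε/ρ` = extension/restriction through the bijective bond window `cB`, `τ` = the chart translation, `s(□) = (c′/L^{j₀})²`, `E_e = L^{j₀}(S_{±λ} − 1)`,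
`Δ_□ = Σ_λ∇_λ*∇_λ`).  THIS FILE (v1 = the geometric half): §1 torus neighbours (`|σ_{±e_μ}z − z|_T ≤ 1`) and **`blkOf_mem_QT_of_near_hT`** — the blocks ADJACENT to
`supp h^T_□` are blocks of `□⁺ = QT □` (`M_h ≥ 8`: block side `≤ L^{j+1} ≤ S/8`); §2 the chart-frame `h^ch_□ = h^T_□ ∘ σ_□ ∘ toBox` (`hch_eq_hT`), its
nearest-neighbour sizes **`abs_hch_shift_sub_le`/`abs_hch_unshift_sub_le`** (`C1F/(8S/5)`) and **`abs_hch_second_le`** (`C2F/(8S/5)²`) from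
`…TorusBinders.abs_hT_sub_le_near/abs_hT_second_diff_le`, the reach membership **`blkOf_σch_mem_QT`** of the blocks at and next to the support, and
`blkV1_translate_vch`.  **v1.1 (p38 gen 28, APPEND-ONLY)**: §3 the window-side values of `ρh` ARE honest values of `h` one lattice step around a
window site for `h` supported on the bonds of margin `1` (`restrictB_apply'`, `restrictB_shift_apply'`, `restrictB_unshift_apply'` — the member torus
does not wrap next to `supp h`; p22's `B6GluedLegsWindow.restrictB_unshift_apply` pattern for every direction), whence the transplanted coefficients are
honest differences: `extend_smul_Dl_apply`/`extend_smul_Dla_apply` (`ε(κ•∇^{(*)}_μ(ρh))(b) = κL^j(h(b ± e_μ) − h(b))`), `extend_smul_lapTS_apply`; §4 THE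
BINDERS OF `h2134_kFam_torus_in` FOR THE CUBE: **`cfC_supp`**/**`c0C_supp`** (`c_e(x) ≠ 0`, `c₀(x) ≠ 0 ⟹ blkV1 x ∈ ST □`) and **`abs_cfC_le`**
(`|c_e(x)| ≤ s₁c′²/(M·len(y(x))²)`, `s₁ := C1F·L³`), **`abs_c0C_le`** (`|c₀(x)| ≤ s₂c′²/(M·len(y(x))²)`, `s₂ := (d+1)·C2F·L`) — the shapes displayed as
hypotheses (iii) of r03's `B6Prop26KLevelAssemblyV1.prop26_2136_kLevel_assembly` (p358050); `s1C_nonneg`, `s2C_nonneg`.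
THEOREMS ONLY; standard axioms.

HONEST SCOPE / DIVERGENCES. (i) Lattice units, `η = 1`.  (ii) `M_h = L^a ≥ 8`, `P′_μ ≥ 5`, `R ≥ 2L²`, placed cube, as in the cube files.  (iii) Bookkeeping
only: no estimate of [6] beyond (1.118)'s sizes is involved; the constants `s₁ = C1F·L³`, `s₂ = (d+1)·C2F·L` depend on `d, L` only (print: «O(1)»), and in
`s₂` the spare factor `(L·M_h)^{−1}` of print's `M^{−1}(L^jη)^{−2}` versus the binder's `M^{−1}len^{−2}` is given away.  Nothing on d = 4 or the continuum;
NOT summit progress.  Unit `lit-balaban-p38` (gen 27: v1; gen 28: v1.1), 2026-08-23.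
-/

noncomputable section

open scoped BigOperators
open Finset

namespace Literature.MathematicalPhysics.QuantumFieldTheory.Balaban1983to89.B6CubeCoeffSizesV1

open LatticeFieldCalculus
open B4ContourShift (supNorm abs_le_supNorm)
open B4Reflection242 (boxDom)
open B4TorusKernel.MultiPeriod (torusSupNorm torusSupNorm_translate torusSupNorm_le_supNorm translate)
open B6MultiLevelBoxOperator (N0 bigSide)
open B6MultiLevelTorusOperator (TDomains tshift tshift_val_eq_translate tshift_tshift unitVec one_le_of_mem)
open B6Geom246MultiLevelBox (bset blkOf toR)
open B6Geom246MultiLevelTorus (torusSupNorm_neg)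
open B6Cover236MultiLevelBlocks (cubes side ctr Q mem_Q)
open B6Eq238MultiLevelTorus (svec)
open B6Partition118KLevelFine (hF dist_lt_of_hF_ne_zero lev_window_of_dist_lt_three_halves)
open B6Partition118KLevelFineSizes (C1F C1F_nonneg)
open B6Partition118KLevelFineSecond (C2F C2F_nonneg)
open B6Partition118KLevelTorus (hT)
open B6Partition118KLevelTorusCentral (Dch σch cc QT side_cc hT_eq_hF_cc lev_blkOf_σch blkOf_mem_QT_of_hT_ne_zero)
open B6Partition118KLevelTorusBinders (abs_hT_sub_le_near abs_hT_second_diff_le torusSupNorm_σch_symm dist_le_one_of_torus siteDeep_three_of_hF_ne_zero)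
open B6TorusDepthDistance (blkOf_eq_blkMap_symm)
open B6Geom246MultiLevelBox (dist_toR_cen_le cen)

variable {d ℓ : ℕ}

/-! ## §1  Torus neighbours; the blocks adjacent to `supp h_□` lie in `□⁺` -/

section Near

variable {Mh k R : ℕ} {P : Fin (d + 1) → ℕ}

/-- `|σ_{±e_μ} z − z|_T ≤ 1`: a unit torus translation moves by one. [cite: Balaban1983RegularityDecay, p.572 («a torus T_η … with periodic conditions»), dictionary] -/
theorem torusSupNorm_tshift_single_le {N : Fin (d + 1) → ℕ} (hN1 : ∀ i, 1 ≤ N i) (μ : Fin (d + 1)) (s : ℤ) (hs : |s| ≤ 1) (z : ↥(boxDom N)) :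
    torusSupNorm N ((tshift N (Pi.single μ s) z).1 - z.1) ≤ 1 := by
  obtain ⟨m, hm⟩ := tshift_val_eq_translate N (Pi.single μ s) z
  have e : (tshift N (Pi.single μ s) z).1 - z.1 = translate N (Pi.single μ s) m := by
    rw [hm]
    funext i
    simp only [Pi.sub_apply, B4TorusKernel.MultiPeriod.translate_apply, Pi.add_apply]
    ring
  rw [e, torusSupNorm_translate]
  refine (torusSupNorm_le_supNorm hN1 _).trans (Finset.sup'_le _ _ fun i _ => ?_)
  by_cases hi : i = μ
  · subst hi
    rw [Pi.single_eq_same]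
    exact_mod_cast hs
  · rw [Pi.single_eq_of_ne hi, abs_zero]
    norm_num

/-- `|σ_{e_μ} z − z|_T ≤ 1`. [cite: Balaban1983RegularityDecay, p.572, dictionary] -/
theorem torusSupNorm_tshift_unitVec_le {N : Fin (d + 1) → ℕ} (hN1 : ∀ i, 1 ≤ N i) (μ : Fin (d + 1)) (z : ↥(boxDom N)) :
    torusSupNorm N ((tshift N (unitVec μ) z).1 - z.1) ≤ 1 :=
  torusSupNorm_tshift_single_le hN1 μ 1 (by norm_num) z

/-- `|σ_{−e_μ} z − z|_T ≤ 1`. [cite: Balaban1983RegularityDecay, p.572, dictionary] -/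
theorem torusSupNorm_tshift_neg_unitVec_le {N : Fin (d + 1) → ℕ} (hN1 : ∀ i, 1 ≤ N i) (μ : Fin (d + 1)) (z : ↥(boxDom N)) :
    torusSupNorm N ((tshift N (-unitVec μ) z).1 - z.1) ≤ 1 := by
  have e : -unitVec μ = (Pi.single μ (-1 : ℤ) : Fin (d + 1) → ℤ) := by
    unfold unitVec; rw [Pi.single_neg]
  rw [e]
  exact torusSupNorm_tshift_single_le hN1 μ (-1) (by norm_num) z

variable (D : TDomains d ℓ Mh k P R)

/-- **THE BLOCKS ADJACENT TO `supp h^T_□` LIE IN `□⁺`** (`M_h ≥ 8`): `h^T_□(z′) ≠ 0`, `|z − z′|_T ≤ 1 ⟹ y(z) ∈ QT □` — the coefficients `E_eh_□`,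
`Δh_□` live one lattice step around `supp h_□`; their blocks are still blocks of the reach (block side `≤ L^{j+1} ≤ S/8`).
[cite: Balaban1984PropagatorsII, p.239/p.247 (supports of h_□, ζ_□ in □̃ — our paraphrase of p.239 «equal to 1 on a cube containing □ … equal to 0 outside a similar cube», not a printed sentence), p.235, bookkeeping] -/
theorem blkOf_mem_QT_of_near_hT (hℓ : 1 ≤ ℓ) (hM8 : 8 ≤ Mh) (hR : 2 * (ℓ + 1) ≤ R) (hP5 : ∀ μ, 5 ≤ P μ) {hMh1 : 1 ≤ Mh} (hP4 : ∀ μ, 4 ≤ P μ)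
    (c : ↥(cubes D.toDomains)) {z z' : ↥(boxDom (N0 ℓ Mh k P))} (h : hT D c z' ≠ 0) (hzz' : torusSupNorm (N0 ℓ Mh k P) (z.1 - z'.1) ≤ 1) :
    blkOf D.toDomains z ∈ QT D hMh1 hP4 c := by
  have hMh : 2 ≤ Mh := le_trans (by norm_num) hM8
  rw [hT_eq_hF_cc hMh1 hP4 c z'] at h
  -- in the canonical chart: `x = σ_c⁻¹ z` is a lattice neighbour of `x′ = σ_c⁻¹ z′ ∈ supp h^F`
  have hT1 : torusSupNorm (N0 ℓ Mh k P) (((σch D c).symm z').1 - ((σch D c).symm z).1) ≤ 1 := by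
    rw [torusSupNorm_σch_symm, show z'.1 - z.1 = -(z.1 - z'.1) by abel, torusSupNorm_neg (one_le_of_mem z.2)]; exact hzz'
  have hnear := dist_le_one_of_torus ((siteDeep_three_of_hF_ne_zero hℓ hMh hR hP5 c h).mono (by norm_num)) hT1
  have hx'c := dist_lt_of_hF_ne_zero (Dch D c) hMh1 h
  set x := (σch D c).symm z with hx
  set x' := (σch D c).symm z' with hx'
  have hnear' : dist (toR x.1) (toR x'.1) ≤ 1 := by rw [dist_comm]; exact hnear
  have hp1 : (1 : ℝ) ≤ (((ℓ + 1) ^ (c.1.1 + 1) : ℕ) : ℝ) := by exact_mod_cast Nat.one_le_pow _ _ (by omega)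
  have hS : side (Dch D c) (cc D hMh1 hP4 c) = (bigSide ℓ Mh c.1.1 : ℝ) := side_cc hMh1 hP4 c
  have h8 : 8 * (((ℓ + 1) ^ (c.1.1 + 1) : ℕ) : ℝ) ≤ side (Dch D c) (cc D hMh1 hP4 c) := by
    rw [hS]; unfold bigSide; push_cast
    have : (8 : ℝ) ≤ Mh := by exact_mod_cast hM8
    have hp : (0 : ℝ) ≤ ((ℓ : ℝ) + 1) ^ (c.1.1 + 1) := by positivity
    nlinarith
  have h32 : dist (toR x.1) (ctr (Dch D c) (cc D hMh1 hP4 c)) < 3 / 2 * side (Dch D c) (cc D hMh1 hP4 c) := by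
    linarith [dist_triangle (toR x.1) (toR x'.1) (ctr (Dch D c) (cc D hMh1 hP4 c))]
  have hlev := (lev_window_of_dist_lt_three_halves (Dch D c) hMh1 hR h32).2
  -- the block of `x` in the chart frame is in `Q`: its centre is within `(L^{j+1} − 1)/2 + 1 + S ≤ 5S/4` of the centre
  have hcen := dist_toR_cen_le (Dch D c) (rfl : blkOf (Dch D c) x = blkOf (Dch D c) x)
  have hL1 : 1 ≤ ℓ + 1 := by omega
  have hpow : (((ℓ + 1) ^ (blkOf (Dch D c) x).1.1 : ℕ) : ℝ) ≤ (((ℓ + 1) ^ (c.1.1 + 1) : ℕ) : ℝ) := by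
    exact_mod_cast Nat.pow_le_pow_right hL1 hlev
  have hQ : blkOf (Dch D c) x ∈ Q (Dch D c) (cc D hMh1 hP4 c) := by
    refine (mem_Q (Dch D c)).2 ?_
    calc dist (cen (Dch D c) (blkOf (Dch D c) x)) (ctr (Dch D c) (cc D hMh1 hP4 c))
        ≤ dist (toR x.1) (cen (Dch D c) (blkOf (Dch D c) x)) + dist (toR x.1) (ctr (Dch D c) (cc D hMh1 hP4 c)) :=
          dist_triangle_left _ _ _
      _ ≤ dist (toR x.1) (cen (Dch D c) (blkOf (Dch D c) x)) + (dist (toR x.1) (toR x'.1) +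
            dist (toR x'.1) (ctr (Dch D c) (cc D hMh1 hP4 c))) := by linarith [dist_triangle (toR x.1) (toR x'.1) (ctr (Dch D c) (cc D hMh1 hP4 c))]
      _ ≤ 5 / 4 * side (Dch D c) (cc D hMh1 hP4 c) := by nlinarith
  -- back to the torus
  unfold QT
  rw [blkOf_eq_blkMap_symm (D := D) hMh1 (fun μ => le_trans (by norm_num) (hP4 μ)) (svec ℓ k c.1.1 c.1.2) z]
  exact Finset.mem_image_of_mem _ hQ

end Near

/-! ## §2  The chart-frame `h_□`: nearest-neighbour sizes and the blocks around its support -/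

section Chart

open B6Ineq2133TwoScaleV1 (onFun onFun_apply)
open B6GlobalChartV1 (PV domT toBox blkV1)
open B6SectAOperatorsV1 (BondIdx)
open B6Prop25TwoScaleCensus (TSIdx)
open B6AgreeLapV1Chart (cB eB eS DeepS mem_cB_W eS_shift eS_unshift eS_injOn deepS_mono shift_mem_deepS unshift_mem_deepS)
open B6TranslateV1 (trV trV_apply)
open B6TranslateTorusV1 (vch toBox_add_tv)
open B6ScalarChartV1 (toBox_shift toBox_unshift)
open B6Prop26KLevelSkeletonV1 (hB ST)
open B6CubeWindowV1 (tC tC_j sc x0 hx0 hfit wC hch hch_apply hch_deep Placed j0 j0_le_level)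
open B6Eq292MemberTorusV1 (cfC c0C)
open B10StarCount (shift_unshift unshift_shift)

variable {hd : 1 ≤ d + 1} {hL : Odd (ℓ + 1) ∧ 1 < ℓ + 1} {a₀ a₁ : ℝ} {m K : ℕ} {Mh k R : ℕ} {P' : Fin (d + 1) → ℕ}
variable (hN : ∀ μ, N0 ℓ Mh k P' μ = (PV d ℓ m K hd hL).sitesPerDir 0) {D : TDomains d ℓ Mh k P' R} (hk : k ≤ m + K)
  (hMh1 : 1 ≤ Mh) (hP4 : ∀ μ, 4 ≤ P' μ) {a : ℕ} (hMha : Mh = (ℓ + 1) ^ a) (c : ↥(cubes D.toDomains)) (ha : a₀ ≤ a₁)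

/-- `h^ch_□(b) = h^T_□(σ_□(toBox b₋))`: the chart-frame `h_□` is the torus `h_□` at the translated site. [cite: Balaban1984PropagatorsII, (2.36) p.229, dictionary (charts)] -/
theorem hch_eq_hT (b : PBond (PV d ℓ m K hd hL) 0) : hch hN hMh1 hP4 c b = hT D c (σch D c (toBox hN b.src)) := by
  rw [hch_apply, hT_eq_hF_cc hMh1 hP4 c, Equiv.symm_apply_apply]

/-- `σ_□` commutes with every torus translation. [cite: Balaban1983RegularityDecay, p.572, dictionary] -/
theorem σch_tshift (v : Fin (d + 1) → ℤ) (z : ↥(boxDom (N0 ℓ Mh k P'))) : σch D c (tshift (N0 ℓ Mh k P') v z) = tshift (N0 ℓ Mh k P') v (σch D c z) := by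
  show tshift _ _ (tshift _ v z) = tshift _ v (tshift _ _ z)
  rw [tshift_tshift, tshift_tshift, add_comm v]

/-- `ℓ ≥ 1` from `Odd (ℓ+1) ∧ 1 < ℓ+1`. [cite: Balaban1984PropagatorsII, p.224 («L odd»), bookkeeping] -/
theorem one_le_ell (hL : Odd (ℓ + 1) ∧ 1 < ℓ + 1) : 1 ≤ ℓ := by have := hL.2; omega

/-- **THE FIRST-STEP SIZE OF `h^ch_□`**: `|h^ch_□(x + e_μ) − h^ch_□(x)| ≤ C1F/(8S/5)` (torus neighbours under `σ_□ ∘ toBox`).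
[cite: Balaban1984PropagatorsII, p.247 («|∂h_□| ≤ O(1)(ML^jη)^{−1}»)] -/
theorem abs_hch_shift_sub_le (hM8 : 8 ≤ Mh) (hR : 2 * (ℓ + 1) ≤ R) (hP5 : ∀ μ, 5 ≤ P' μ) (x : Site (PV d ℓ m K hd hL) 0)
    (dir μ : Fin (d + 1)) :
    |hch hN hMh1 hP4 c ⟨x.shift μ, dir⟩ - hch hN hMh1 hP4 c ⟨x, dir⟩| ≤ C1F d ℓ / (8 / 5 * (bigSide ℓ Mh c.1.1 : ℝ)) := by
  have hMh : 2 ≤ Mh := le_trans (by norm_num) hM8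
  rw [hch_eq_hT, hch_eq_hT]
  dsimp only
  rw [toBox_shift hN, σch_tshift]
  refine abs_hT_sub_le_near (one_le_ell hL) hMh hR hP5 c ?_
  rw [show (σch D c (toBox hN x)).1 - (tshift (N0 ℓ Mh k P') (unitVec μ) (σch D c (toBox hN x))).1 =
      -((tshift (N0 ℓ Mh k P') (unitVec μ) (σch D c (toBox hN x))).1 - (σch D c (toBox hN x)).1) by abel,
    torusSupNorm_neg (one_le_of_mem (σch D c (toBox hN x)).2)]
  exact torusSupNorm_tshift_unitVec_le (one_le_of_mem (σch D c (toBox hN x)).2) μ _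

/-- **THE FIRST-STEP SIZE, BACKWARDS**: `|h^ch_□(x − e_μ) − h^ch_□(x)| ≤ C1F/(8S/5)`. [cite: Balaban1984PropagatorsII, p.247] -/
theorem abs_hch_unshift_sub_le (hM8 : 8 ≤ Mh) (hR : 2 * (ℓ + 1) ≤ R) (hP5 : ∀ μ, 5 ≤ P' μ) (x : Site (PV d ℓ m K hd hL) 0)
    (dir μ : Fin (d + 1)) :
    |hch hN hMh1 hP4 c ⟨x.unshift μ, dir⟩ - hch hN hMh1 hP4 c ⟨x, dir⟩| ≤ C1F d ℓ / (8 / 5 * (bigSide ℓ Mh c.1.1 : ℝ)) := by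
  have h := abs_hch_shift_sub_le hN hMh1 hP4 c hM8 hR hP5 (x.unshift μ) dir μ
  rw [shift_unshift] at h
  rwa [abs_sub_comm] at h

/-- **THE SECOND-STEP SIZE OF `h^ch_□`**: `|h^ch_□(x + e_μ) − 2h^ch_□(x) + h^ch_□(x − e_μ)| ≤ C2F/(8S/5)²`.
[cite: Balaban1984PropagatorsII, p.247 («|Δh_□| ≤ O(1)M^{−1}(L^jη)^{−2}»)] -/
theorem abs_hch_second_le (hR : 2 * (ℓ + 1) ≤ R) (hP5 : ∀ μ, 5 ≤ P' μ) (hMh : 2 ≤ Mh) (x : Site (PV d ℓ m K hd hL) 0)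
    (dir μ : Fin (d + 1)) :
    |hch hN hMh1 hP4 c ⟨x.shift μ, dir⟩ - 2 * hch hN hMh1 hP4 c ⟨x, dir⟩ + hch hN hMh1 hP4 c ⟨x.unshift μ, dir⟩|
      ≤ C2F d ℓ / (8 / 5 * (bigSide ℓ Mh c.1.1 : ℝ)) ^ 2 := by
  rw [hch_eq_hT, hch_eq_hT, hch_eq_hT]
  dsimp only
  rw [toBox_shift hN, toBox_unshift hN, σch_tshift, σch_tshift]
  exact abs_hT_second_diff_le (one_le_ell hL) hMh hR hP5 c μ _

/-- **THE BLOCKS AROUND `supp h^ch_□` ARE BLOCKS OF THE REACH**: `h^ch_□(x′) ≠ 0` for a lattice neighbour `x′ ∈ {x, x ± e_μ}` ⟹ the torus block of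
`σ_□(toBox x)` lies in `QT □`. [cite: Balaban1984PropagatorsII, p.239/p.247 (supports of h_□, ζ_□ in □̃ — our paraphrase of p.239 «equal to 1 on a cube containing □ … equal to 0 outside a similar cube», not a printed sentence), p.235] -/
theorem blkOf_σch_mem_QT (hM8 : 8 ≤ Mh) (hR : 2 * (ℓ + 1) ≤ R) (hP5 : ∀ μ, 5 ≤ P' μ) (x : Site (PV d ℓ m K hd hL) 0)
    {dir : Fin (d + 1)} {μ : Fin (d + 1)}
    (h : hch hN hMh1 hP4 c ⟨x, dir⟩ ≠ 0 ∨ hch hN hMh1 hP4 c ⟨x.shift μ, dir⟩ ≠ 0 ∨ hch hN hMh1 hP4 c ⟨x.unshift μ, dir⟩ ≠ 0) :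
    blkOf D.toDomains (σch D c (toBox hN x)) ∈ QT D hMh1 hP4 c := by
  have hℓ : 1 ≤ ℓ := one_le_ell hL
  have hMh : 2 ≤ Mh := le_trans (by norm_num) hM8
  have h1 : ∀ i, 1 ≤ N0 ℓ Mh k P' i := one_le_of_mem (σch D c (toBox hN x)).2
  rcases h with h | h | h
  · rw [hch_eq_hT] at h
    exact blkOf_mem_QT_of_hT_ne_zero hMh hR hP4 c h
  · rw [hch_eq_hT] at h
    dsimp only at h
    rw [toBox_shift hN, σch_tshift] at h
    refine blkOf_mem_QT_of_near_hT D hℓ hM8 hR hP5 hP4 c h ?_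
    rw [show (σch D c (toBox hN x)).1 - (tshift (N0 ℓ Mh k P') (unitVec μ) (σch D c (toBox hN x))).1 =
        -((tshift (N0 ℓ Mh k P') (unitVec μ) (σch D c (toBox hN x))).1 - (σch D c (toBox hN x)).1) by abel, torusSupNorm_neg h1]
    exact torusSupNorm_tshift_unitVec_le h1 μ _
  · rw [hch_eq_hT] at h
    dsimp only at h
    rw [toBox_unshift hN, σch_tshift] at h
    refine blkOf_mem_QT_of_near_hT D hℓ hM8 hR hP5 hP4 c h ?_
    rw [show (σch D c (toBox hN x)).1 - (tshift (N0 ℓ Mh k P') (-unitVec μ) (σch D c (toBox hN x))).1 =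
        -((tshift (N0 ℓ Mh k P') (-unitVec μ) (σch D c (toBox hN x))).1 - (σch D c (toBox hN x)).1) by abel, torusSupNorm_neg h1]
    exact torusSupNorm_tshift_neg_unitVec_le h1 μ _

/-- the torus block of the translated bond: `blkV1(b + v_□) = blkOf(σ_□(toBox b₋))`. [cite: Balaban1984PropagatorsII, (2.45) p.231, dictionary (charts)] -/
theorem blkV1_translate_vch (b : PBond (PV d ℓ m K hd hL) 0) :
    blkV1 hN D (b.translate (vch Mh k (svec ℓ k c.1.1 c.1.2))) = blkOf D.toDomains (σch D c (toBox hN b.src)) := by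
  unfold blkV1
  rw [PBond.translate_src, toBox_add_tv]

end Chart

/-! ## §3  (v1.1) The window-side differences of `ρh` are honest differences of `h`; the sizes and supports of `c_e`, `c₀` -/

section Window

open B6Ineq2133TwoScaleV1 (onFun onFun_apply)
open B6GlobalChartV1 (PV)
open B6Prop25TwoScaleCensus (TSIdx)
open B6AgreeLapV1Chart (cB eB eS DeepS mem_cB_W cB_e eS_shift eS_injOn deepS_mono eS_shift_eq_iff eS_shift_eq_iff')
open B6Prop26ReachTransplant (restrictOp extendOp restrictOp_apply_of_injOn extendOp_apply)
open B10StarCount (shift_unshift unshift_shift)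

variable {hd : 1 ≤ d + 1} {hL : Odd (ℓ + 1) ∧ 1 < ℓ + 1} {a₀ a₁ : ℝ} {m K : ℕ}
variable {t : TSIdx d (ℓ + 1) hd hL a₀ a₁} {x₀ : Fin (d + 1) → ℤ}
variable {hx₀ : ∀ μ, 0 ≤ x₀ μ} {hfit : ∀ μ, x₀ μ + (t.P.sitesPerDir 0 : ℕ) ≤ ((PV d ℓ m K hd hL).sitesPerDir 0 : ℕ)}

/-- `(ρh)⟨e y, ν⟩ = h⟨y, ν⟩` for a window site `y` (a function on `□̃³ ⊂ T_η` IS a function on `T_□`). [cite: Balaban1984PropagatorsII, p.238 (T_□ = □̃³), dictionary] -/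
theorem restrictB_apply' (h : PBond (PV d ℓ m K hd hL) 0 → ℝ) {y : Site (PV d ℓ m K hd hL) 0} (hy : y ∈ DeepS t x₀ 0) (ν : Fin (d + 1)) :
    restrictOp (cB t x₀ hx₀ hfit).W (eB t x₀) h ⟨eS t x₀ y, ν⟩ = h ⟨y, ν⟩ := by
  have hinjB := (cB t x₀ hx₀ hfit).inj
  simp only [cB_e] at hinjB
  exact restrictOp_apply_of_injOn hinjB h (x := ⟨y, ν⟩) (mem_cB_W.2 hy)

/-- **THE FORWARD NEIGHBOUR THROUGH THE CHART**: `(ρh)⟨e y + e_μ, ν⟩ = h⟨y + e_μ, ν⟩` for a window site `y` and a bond function `h` supported on the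
bonds of margin `1` (the member torus `T_□` does not wrap next to `supp h`). [cite: Balaban1984PropagatorsII, p.238–239 (T_□ = □̃³; operators on T_□ «as in (2.19)»), dictionary] -/
theorem restrictB_shift_apply' {h : PBond (PV d ℓ m K hd hL) 0 → ℝ} (hh : ∀ b, h b ≠ 0 → b.src ∈ DeepS t x₀ 1)
    {y : Site (PV d ℓ m K hd hL) 0} (hy : y ∈ DeepS t x₀ 0) (μ ν : Fin (d + 1)) :
    restrictOp (cB t x₀ hx₀ hfit).W (eB t x₀) h ⟨(eS t x₀ y).shift μ, ν⟩ = h ⟨y.shift μ, ν⟩ := by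
  have hinjB := (cB t x₀ hx₀ hfit).inj
  simp only [cB_e] at hinjB
  obtain ⟨b'', hb''W, hb''⟩ := (cB t x₀ hx₀ hfit).surj ⟨(eS t x₀ y).shift μ, ν⟩
  rw [cB_e] at hb''
  rw [← hb'', restrictOp_apply_of_injOn hinjB h hb''W]
  obtain ⟨s, dd⟩ := b''
  have hdir : dd = ν := congrArg PBond.dir hb''
  have hsrc : eS t x₀ s = (eS t x₀ y).shift μ := congrArg PBond.src hb''
  subst hdir
  have hsW : s ∈ DeepS t x₀ 0 := mem_cB_W.1 hb''W
  by_cases h1 : h ⟨s, dd⟩ = 0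
  · by_cases h2 : h ⟨y.shift μ, dd⟩ = 0
    · rw [h1, h2]
    · have hys : y.shift μ ∈ DeepS t x₀ 1 := hh _ h2
      have he : (eS t x₀ y).shift μ = eS t x₀ (y.shift μ) := (eS_shift_eq_iff hx₀ hy hys μ).2 rfl
      have hs : s = y.shift μ := eS_injOn hsW (deepS_mono (by omega) hys) (hsrc.trans he)
      rw [hs]
  · have hs1 : s ∈ DeepS t x₀ 1 := hh _ h1
    have hs : y.shift μ = s := (eS_shift_eq_iff hx₀ hy hs1 μ).1 hsrc.symm
    rw [hs]

/-- **THE BACKWARD NEIGHBOUR THROUGH THE CHART**: `(ρh)⟨e y − e_μ, ν⟩ = h⟨y − e_μ, ν⟩` (same hypotheses). [cite: Balaban1984PropagatorsII, p.238–239 (T_□ = □̃³), dictionary] -/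
theorem restrictB_unshift_apply' {h : PBond (PV d ℓ m K hd hL) 0 → ℝ} (hh : ∀ b, h b ≠ 0 → b.src ∈ DeepS t x₀ 1)
    {y : Site (PV d ℓ m K hd hL) 0} (hy : y ∈ DeepS t x₀ 0) (μ ν : Fin (d + 1)) :
    restrictOp (cB t x₀ hx₀ hfit).W (eB t x₀) h ⟨(eS t x₀ y).unshift μ, ν⟩ = h ⟨y.unshift μ, ν⟩ := by
  have hinjB := (cB t x₀ hx₀ hfit).inj
  simp only [cB_e] at hinjB
  obtain ⟨b'', hb''W, hb''⟩ := (cB t x₀ hx₀ hfit).surj ⟨(eS t x₀ y).unshift μ, ν⟩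
  rw [cB_e] at hb''
  rw [← hb'', restrictOp_apply_of_injOn hinjB h hb''W]
  obtain ⟨s, dd⟩ := b''
  have hdir : dd = ν := congrArg PBond.dir hb''
  have hsrc : eS t x₀ s = (eS t x₀ y).unshift μ := congrArg PBond.src hb''
  subst hdir
  have hsW : s ∈ DeepS t x₀ 0 := mem_cB_W.1 hb''W
  by_cases h1 : h ⟨s, dd⟩ = 0
  · by_cases h2 : h ⟨y.unshift μ, dd⟩ = 0
    · rw [h1, h2]
    · have hyu : y.unshift μ ∈ DeepS t x₀ 1 := hh _ h2
      have he : (eS t x₀ y).unshift μ = eS t x₀ (y.unshift μ) := by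
        have h3 := eS_shift hfit hyu μ
        rw [shift_unshift] at h3
        rw [h3, unshift_shift]
      have hs : s = y.unshift μ := eS_injOn hsW (deepS_mono (by omega) hyu) (hsrc.trans he)
      rw [hs]
  · have hs1 : s ∈ DeepS t x₀ 1 := hh _ h1
    have hsh : s.shift μ = y := (eS_shift_eq_iff' hfit hs1 hy μ).1 (by rw [hsrc, shift_unshift])
    rw [← hsh, unshift_shift]

/-- `∇_μ` of `T_□` read at a charted bond (unfolding). [cite: Balaban1984PropagatorsI, (1.4) p.18, dictionary] -/
private theorem Dl_toLp_eB (A : PBond t.P 0 → ℝ) (μ : Fin (d + 1)) (y : Site (PV d ℓ m K hd hL) 0) (ν : Fin (d + 1)) :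
    t.Dl μ (WithLp.toLp 2 A) (eB t x₀ ⟨y, ν⟩) = ((((ℓ + 1 : ℕ) : ℝ)) ^ t.j) * (A ⟨(eS t x₀ y).shift μ, ν⟩ - A ⟨eS t x₀ y, ν⟩) :=
  TSIdx.Dl_apply t μ _ _

/-- `∇_μ*` of `T_□` read at a charted bond (unfolding). [cite: Balaban1984PropagatorsI, (1.4) p.18, (1.89) p.33, dictionary] -/
private theorem Dla_toLp_eB (A : PBond t.P 0 → ℝ) (μ : Fin (d + 1)) (y : Site (PV d ℓ m K hd hL) 0) (ν : Fin (d + 1)) :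
    t.Dla μ (WithLp.toLp 2 A) (eB t x₀ ⟨y, ν⟩) = ((((ℓ + 1 : ℕ) : ℝ)) ^ t.j) * (A ⟨(eS t x₀ y).unshift μ, ν⟩ - A ⟨eS t x₀ y, ν⟩) :=
  TSIdx.Dla_apply t μ _ _

/-- `Δ = Σ_μ ∇_μ*∇_μ` of `T_□` read at a charted bond (unfolding). [cite: Balaban1984PropagatorsI, (1.21) p.21, dictionary] -/
private theorem lapTS_toLp_eB (A : PBond t.P 0 → ℝ) (y : Site (PV d ℓ m K hd hL) 0) (ν : Fin (d + 1)) :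
    t.lapTS (WithLp.toLp 2 A) (eB t x₀ ⟨y, ν⟩) =
      ∑ μ : Fin (d + 1), (((((ℓ + 1 : ℕ) : ℝ)) ^ t.j) ^ 2) * (2 * A ⟨eS t x₀ y, ν⟩ - A ⟨(eS t x₀ y).unshift μ, ν⟩ - A ⟨(eS t x₀ y).shift μ, ν⟩) :=
  TSIdx.lapTS_apply t _ _

/-- **THE TRANSPLANTED FIRST-ORDER COEFFICIENT IS THE HONEST FORWARD DIFFERENCE**: `ε(κ•∇_μ(ρh))(b) = κ·Lʲ·(h(b + e_μ) − h(b))` on window bonds `b`,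
for `h` supported on the bonds of margin `1`. [cite: Balaban1984PropagatorsII, (2.92) p.239 (line 1: «(∂h_□)(b)»); Balaban1984PropagatorsI, (1.4) p.18] -/
theorem extend_smul_Dl_apply (κ : ℝ) {h : PBond (PV d ℓ m K hd hL) 0 → ℝ} (hh : ∀ b, h b ≠ 0 → b.src ∈ DeepS t x₀ 1)
    (μ : Fin (d + 1)) (y : Site (PV d ℓ m K hd hL) 0) (ν : Fin (d + 1)) (hy : y ∈ DeepS t x₀ 0) :
    extendOp (cB t x₀ hx₀ hfit).W (eB t x₀) (κ • onFun (t.Dl μ) (restrictOp (cB t x₀ hx₀ hfit).W (eB t x₀) h)) ⟨y, ν⟩ =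
      κ * ((((ℓ + 1 : ℕ) : ℝ)) ^ t.j * (h ⟨y.shift μ, ν⟩ - h ⟨y, ν⟩)) := by
  rw [extendOp_apply, if_pos (mem_cB_W.2 hy), Pi.smul_apply, smul_eq_mul, onFun_apply, Dl_toLp_eB,
    restrictB_shift_apply' hh hy, restrictB_apply' h hy]

/-- **… AND THE HONEST BACKWARD DIFFERENCE**: `ε(κ•∇_μ*(ρh))(b) = κ·Lʲ·(h(b − e_μ) − h(b))` on window bonds.
[cite: Balaban1984PropagatorsII, (2.92) p.239 (line 1); Balaban1984PropagatorsI, (1.4) p.18, (1.89) p.33] -/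
theorem extend_smul_Dla_apply (κ : ℝ) {h : PBond (PV d ℓ m K hd hL) 0 → ℝ} (hh : ∀ b, h b ≠ 0 → b.src ∈ DeepS t x₀ 1)
    (μ : Fin (d + 1)) (y : Site (PV d ℓ m K hd hL) 0) (ν : Fin (d + 1)) (hy : y ∈ DeepS t x₀ 0) :
    extendOp (cB t x₀ hx₀ hfit).W (eB t x₀) (κ • onFun (t.Dla μ) (restrictOp (cB t x₀ hx₀ hfit).W (eB t x₀) h)) ⟨y, ν⟩ =
      κ * ((((ℓ + 1 : ℕ) : ℝ)) ^ t.j * (h ⟨y.unshift μ, ν⟩ - h ⟨y, ν⟩)) := by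
  rw [extendOp_apply, if_pos (mem_cB_W.2 hy), Pi.smul_apply, smul_eq_mul, onFun_apply, Dla_toLp_eB,
    restrictB_unshift_apply' hh hy, restrictB_apply' h hy]

/-- **THE TRANSPLANTED ZEROTH-ORDER COEFFICIENT IS THE HONEST SECOND DIFFERENCE**: `ε(κ•Δ(ρh))(b) = κ·Σ_ν L^{2j}(2h(b) − h(b − e_ν) − h(b + e_ν))`
on window bonds. [cite: Balaban1984PropagatorsII, (2.92) p.239 (line 1: «(Δh_□)(x)»); Balaban1984PropagatorsI, (1.21) p.21] -/
theorem extend_smul_lapTS_apply (κ : ℝ) {h : PBond (PV d ℓ m K hd hL) 0 → ℝ} (hh : ∀ b, h b ≠ 0 → b.src ∈ DeepS t x₀ 1)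
    (y : Site (PV d ℓ m K hd hL) 0) (ν : Fin (d + 1)) (hy : y ∈ DeepS t x₀ 0) :
    extendOp (cB t x₀ hx₀ hfit).W (eB t x₀) (κ • onFun t.lapTS (restrictOp (cB t x₀ hx₀ hfit).W (eB t x₀) h)) ⟨y, ν⟩ =
      κ * ∑ μ : Fin (d + 1), ((((ℓ + 1 : ℕ) : ℝ)) ^ t.j) ^ 2 * (2 * h ⟨y, ν⟩ - h ⟨y.unshift μ, ν⟩ - h ⟨y.shift μ, ν⟩) := by
  rw [extendOp_apply, if_pos (mem_cB_W.2 hy), Pi.smul_apply, smul_eq_mul, onFun_apply, lapTS_toLp_eB]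
  simp only [restrictB_unshift_apply' hh hy, restrictB_shift_apply' hh hy, restrictB_apply' h hy]

/-- off the window every transplanted coefficient vanishes. [cite: Balaban1984PropagatorsII, p.238 (T_□ = □̃³), dictionary] -/
theorem extend_apply_of_not_mem (g : PBond t.P 0 → ℝ) {b : PBond (PV d ℓ m K hd hL) 0} (hb : b.src ∉ DeepS t x₀ 0) :
    extendOp (cB t x₀ hx₀ hfit).W (eB t x₀) g b = 0 := by
  rw [extendOp_apply, if_neg (fun h => hb (mem_cB_W.1 h))]

end Window

/-! ## §4  (v1.1) THE BINDERS `hcf`, `hcfT`, `hc₀`, `hc₀T` OF `h2134_kFam_torus_in` FOR THE CUBE'S `cfC`, `c0C` -/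

section Coeff

open B6Ineq2133TwoScaleV1 (onFun onFun_apply)
open B6GlobalChartV1 (PV domT toBox blkV1)
open B6SectAOperatorsV1 (BondIdx)
open B6Prop25TwoScaleCensus (TSIdx)
open B6AgreeLapV1Chart (cB eB eS DeepS mem_cB_W deepS_mono)
open B6Prop26ReachTransplant (restrictOp extendOp extendOp_apply)
open B6TranslateV1 (trV trV_apply)
open B6TranslateTorusV1 (vch)
open B6Geom246MultiLevelTorus (geomT blkMap)
open B8Ineq192MultiLevelTorus (geomTB geomTB_len geomTB_M)
open B6Cover236MultiLevelBlocks (window)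
open B6Prop26KLevelSkeletonV1 (ST mem_ST)
open B6CubeWindowV1 (tC tC_j sc x0 hx0 hfit wC hch hch_deep Placed j0 j0_le_level)
open B6Eq292MemberTorusV1 (cfC c0C)
open B10StarCount (shift_unshift unshift_shift)

variable {hd : 1 ≤ d + 1} {hL : Odd (ℓ + 1) ∧ 1 < ℓ + 1} {a₀ a₁ : ℝ} {m K : ℕ} {Mh k R : ℕ} {P' : Fin (d + 1) → ℕ}
variable (hN : ∀ μ, N0 ℓ Mh k P' μ = (PV d ℓ m K hd hL).sitesPerDir 0) {D : TDomains d ℓ Mh k P' R} (hk : k ≤ m + K)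
  (hMh1 : 1 ≤ Mh) (hP4 : ∀ μ, 4 ≤ P' μ) {a : ℕ} (hMha : Mh = (ℓ + 1) ^ a) (c : ↥(cubes D.toDomains)) (ha : a₀ ≤ a₁)

/-- `(x − v) + v = x` for bonds. [folklore] -/
private theorem translate_neg_translate {P : Params} (v : Site P 0) (x : PBond P 0) : (x.translate (-v)).translate v = x :=
  (PBond.translateEquiv v).apply_symm_apply x

/-- **THE BLOCKS OF `□⁺ = QT □` HAVE LEVEL `≤ j + 1`** (the two-level window of the reach). [cite: Balaban1984PropagatorsII, p.235 («either □̃ ⊂ B^j(Λ_j), or it intersects B^{j+1}(Λ_{j+1}) also»), (2.2) p.224] -/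
theorem level_le_of_mem_QT (hR : 2 * (ℓ + 1) ≤ R) {y : ↥(bset D.toDomains)} (hy : y ∈ QT D hMh1 hP4 c) : y.1.1 ≤ c.1.1 + 1 := by
  obtain ⟨y', hy', rfl⟩ := Finset.mem_image.1 hy
  rw [B6TranslateTorusV1.blkMap_fst D hMh1 (fun μ => le_trans (by norm_num) (hP4 μ))]
  exact (window (Dch D c) hMh1 hR hy').2

include hMha in
/-- `supp h^ch_□` has margin `1` in the window of the member (it has margin `4L^{j₀+1}`, r03's `hch_deep`). [cite: Balaban1984PropagatorsII, p.238 (□ ⊂ □̃³), bookkeeping] -/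
theorem hch_deep1 (hM8 : 8 ≤ Mh) (hR2 : 2 * (ℓ + 1) ^ 2 ≤ R) (w : BondIdx (domT hN D hk) → ℝ) (cf : ℝ)
    (b : PBond (PV d ℓ m K hd hL) 0) (hb : hch hN hMh1 hP4 c b ≠ 0) :
    b.src ∈ DeepS (tC hN hk hMh1 hP4 c ha a (wC hN hk c w) cf) (x0 ℓ Mh k c.1) 1 :=
  deepS_mono (Nat.succ_le_of_lt (by positivity)) (hch_deep hN hMh1 hP4 hMha c ha hM8 hR2 hb)

/-- **THE CHART-FRAME VALUE OF `c_e`**: `|ε(s(□)•E_e(ρh^ch_□))(b)| ≤ s(□)·L^{j₀}·C1F/(8S/5)` for every bond `b` (`M_h ≥ 8`, `R ≥ 2L²`, `P′ ≥ 5`):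
the window-side difference is the honest nearest-neighbour difference of `h^ch_□` (§3), whose size is (1.118)'s (§2).
[cite: Balaban1984PropagatorsII, p.247 («|∂h_□| ≤ O(1)(ML^jη)^{−1}»), (2.92) p.239 (line 1), (2.94) p.239] -/
theorem abs_cfC_chart_le (hM8 : 8 ≤ Mh) (hR2 : 2 * (ℓ + 1) ^ 2 ≤ R) (hP5 : ∀ μ, 5 ≤ P' μ) (hpl : Placed ℓ k P' c.1)
    (w : BondIdx (domT hN D hk) → ℝ) (cf : ℝ) (e : Fin (d + 1) × Bool) (b : PBond (PV d ℓ m K hd hL) 0) :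
    |extendOp (cB (tC hN hk hMh1 hP4 c ha a (wC hN hk c w) cf) (x0 ℓ Mh k c.1) (hx0 hpl) (hfit hN hMh1 hP4 hMha c ha hpl)).W
        (eB (tC hN hk hMh1 hP4 c ha a (wC hN hk c w) cf) (x0 ℓ Mh k c.1))
        (sc hMh1 hP4 c cf • onFun (if e.2 then (tC hN hk hMh1 hP4 c ha a (wC hN hk c w) cf).Dl e.1 else (tC hN hk hMh1 hP4 c ha a (wC hN hk c w) cf).Dla e.1)
          (restrictOp (cB (tC hN hk hMh1 hP4 c ha a (wC hN hk c w) cf) (x0 ℓ Mh k c.1) (hx0 hpl) (hfit hN hMh1 hP4 hMha c ha hpl)).W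
            (eB (tC hN hk hMh1 hP4 c ha a (wC hN hk c w) cf) (x0 ℓ Mh k c.1)) (hch hN hMh1 hP4 c))) b|
      ≤ sc hMh1 hP4 c cf * (((ℓ + 1 : ℕ) : ℝ)) ^ j0 hMh1 hP4 c * (C1F d ℓ / (8 / 5 * (bigSide ℓ Mh c.1.1 : ℝ))) := by
  have hR : 2 * (ℓ + 1) ≤ R := le_trans (by nlinarith : 2 * (ℓ + 1) ≤ 2 * (ℓ + 1) ^ 2) hR2
  have hsc : 0 ≤ sc hMh1 hP4 c cf := by unfold sc; positivity
  have hnn : 0 ≤ sc hMh1 hP4 c cf * (((ℓ + 1 : ℕ) : ℝ)) ^ j0 hMh1 hP4 c * (C1F d ℓ / (8 / 5 * (bigSide ℓ Mh c.1.1 : ℝ))) := by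
    have := C1F_nonneg d ℓ
    positivity
  have hh := hch_deep1 hN hk hMh1 hP4 hMha c ha hM8 hR2 w cf
  obtain ⟨y, ν⟩ := b
  by_cases hy : y ∈ DeepS (tC hN hk hMh1 hP4 c ha a (wC hN hk c w) cf) (x0 ℓ Mh k c.1) 0
  · have hLj : (0 : ℝ) ≤ (((ℓ + 1 : ℕ) : ℝ)) ^ j0 hMh1 hP4 c := by positivity
    obtain ⟨μ, s⟩ := e
    cases s
    · simp only [Bool.false_eq_true, if_false]
      rw [extend_smul_Dla_apply _ hh μ y ν hy, tC_j, abs_mul, abs_mul, abs_of_nonneg hsc, abs_of_nonneg hLj, ← mul_assoc]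
      exact mul_le_mul_of_nonneg_left (abs_hch_unshift_sub_le hN hMh1 hP4 c hM8 hR hP5 y ν μ) (mul_nonneg hsc hLj)
    · simp only [if_true]
      rw [extend_smul_Dl_apply _ hh μ y ν hy, tC_j, abs_mul, abs_mul, abs_of_nonneg hsc, abs_of_nonneg hLj, ← mul_assoc]
      exact mul_le_mul_of_nonneg_left (abs_hch_shift_sub_le hN hMh1 hP4 c hM8 hR hP5 y ν μ) (mul_nonneg hsc hLj)
  · rw [extend_apply_of_not_mem _ hy, abs_zero]
    exact hnn

/-- **THE CHART-FRAME SUPPORT OF `c_e`**: `ε(s(□)•E_e(ρh^ch_□))(b) ≠ 0 ⟹` the torus block of `σ_□(toBox b₋)` lies in `QT □` (the coefficient is a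
difference of `h^ch_□` at `b` and a lattice neighbour; §2 `blkOf_σch_mem_QT`). [cite: Balaban1984PropagatorsII, p.239/p.247 (supports of h_□, ζ_□ in □̃ — our paraphrase of p.239 «equal to 1 on a cube containing □ … equal to 0 outside a similar cube», not a printed sentence), p.235] -/
theorem blkOf_mem_QT_of_cfC_chart_ne_zero (hM8 : 8 ≤ Mh) (hR2 : 2 * (ℓ + 1) ^ 2 ≤ R) (hP5 : ∀ μ, 5 ≤ P' μ) (hpl : Placed ℓ k P' c.1)
    (w : BondIdx (domT hN D hk) → ℝ) (cf : ℝ) (e : Fin (d + 1) × Bool) (b : PBond (PV d ℓ m K hd hL) 0)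
    (hb : extendOp (cB (tC hN hk hMh1 hP4 c ha a (wC hN hk c w) cf) (x0 ℓ Mh k c.1) (hx0 hpl) (hfit hN hMh1 hP4 hMha c ha hpl)).W
        (eB (tC hN hk hMh1 hP4 c ha a (wC hN hk c w) cf) (x0 ℓ Mh k c.1))
        (sc hMh1 hP4 c cf • onFun (if e.2 then (tC hN hk hMh1 hP4 c ha a (wC hN hk c w) cf).Dl e.1 else (tC hN hk hMh1 hP4 c ha a (wC hN hk c w) cf).Dla e.1)
          (restrictOp (cB (tC hN hk hMh1 hP4 c ha a (wC hN hk c w) cf) (x0 ℓ Mh k c.1) (hx0 hpl) (hfit hN hMh1 hP4 hMha c ha hpl)).W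
            (eB (tC hN hk hMh1 hP4 c ha a (wC hN hk c w) cf) (x0 ℓ Mh k c.1)) (hch hN hMh1 hP4 c))) b ≠ 0) :
    blkOf D.toDomains (σch D c (toBox hN b.src)) ∈ QT D hMh1 hP4 c := by
  have hR : 2 * (ℓ + 1) ≤ R := le_trans (by nlinarith : 2 * (ℓ + 1) ≤ 2 * (ℓ + 1) ^ 2) hR2
  have hh := hch_deep1 hN hk hMh1 hP4 hMha c ha hM8 hR2 w cf
  obtain ⟨y, ν⟩ := b
  by_cases hy : y ∈ DeepS (tC hN hk hMh1 hP4 c ha a (wC hN hk c w) cf) (x0 ℓ Mh k c.1) 0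
  · obtain ⟨μ, s⟩ := e
    cases s
    · simp only [Bool.false_eq_true, if_false] at hb
      rw [extend_smul_Dla_apply _ hh μ y ν hy] at hb
      have hne : hch hN hMh1 hP4 c ⟨y, ν⟩ ≠ 0 ∨ hch hN hMh1 hP4 c ⟨y.shift μ, ν⟩ ≠ 0 ∨ hch hN hMh1 hP4 c ⟨y.unshift μ, ν⟩ ≠ 0 := by
        by_contra hcon
        push Not at hcon
        obtain ⟨h1, -, h3⟩ := hcon
        exact hb (by rw [h1, h3]; ring)
      exact blkOf_σch_mem_QT hN hMh1 hP4 c hM8 hR hP5 y hne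
    · simp only [if_true] at hb
      rw [extend_smul_Dl_apply _ hh μ y ν hy] at hb
      have hne : hch hN hMh1 hP4 c ⟨y, ν⟩ ≠ 0 ∨ hch hN hMh1 hP4 c ⟨y.shift μ, ν⟩ ≠ 0 ∨ hch hN hMh1 hP4 c ⟨y.unshift μ, ν⟩ ≠ 0 := by
        by_contra hcon
        push Not at hcon
        obtain ⟨h1, h2, -⟩ := hcon
        exact hb (by rw [h1, h2]; ring)
      exact blkOf_σch_mem_QT hN hMh1 hP4 c hM8 hR hP5 y hne
  · exact absurd (extend_apply_of_not_mem _ hy) hb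

/-- **THE CHART-FRAME VALUE OF `c₀`**: `|ε(s(□)•Δ(ρh^ch_□))(b)| ≤ s(□)·(d+1)·L^{2j₀}·C2F/(8S/5)²`.
[cite: Balaban1984PropagatorsII, p.247 («|Δh_□| ≤ O(1)M^{−1}(L^jη)^{−2}»), (2.92) p.239 (line 1), (2.94) p.239] -/
theorem abs_c0C_chart_le (hM8 : 8 ≤ Mh) (hR2 : 2 * (ℓ + 1) ^ 2 ≤ R) (hP5 : ∀ μ, 5 ≤ P' μ) (hpl : Placed ℓ k P' c.1)
    (w : BondIdx (domT hN D hk) → ℝ) (cf : ℝ) (b : PBond (PV d ℓ m K hd hL) 0) :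
    |extendOp (cB (tC hN hk hMh1 hP4 c ha a (wC hN hk c w) cf) (x0 ℓ Mh k c.1) (hx0 hpl) (hfit hN hMh1 hP4 hMha c ha hpl)).W
        (eB (tC hN hk hMh1 hP4 c ha a (wC hN hk c w) cf) (x0 ℓ Mh k c.1))
        (sc hMh1 hP4 c cf • onFun (tC hN hk hMh1 hP4 c ha a (wC hN hk c w) cf).lapTS
          (restrictOp (cB (tC hN hk hMh1 hP4 c ha a (wC hN hk c w) cf) (x0 ℓ Mh k c.1) (hx0 hpl) (hfit hN hMh1 hP4 hMha c ha hpl)).W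
            (eB (tC hN hk hMh1 hP4 c ha a (wC hN hk c w) cf) (x0 ℓ Mh k c.1)) (hch hN hMh1 hP4 c))) b|
      ≤ sc hMh1 hP4 c cf * (((d : ℝ) + 1) * (((((ℓ + 1 : ℕ) : ℝ)) ^ j0 hMh1 hP4 c) ^ 2 * (C2F d ℓ / (8 / 5 * (bigSide ℓ Mh c.1.1 : ℝ)) ^ 2))) := by
  have hR : 2 * (ℓ + 1) ≤ R := le_trans (by nlinarith : 2 * (ℓ + 1) ≤ 2 * (ℓ + 1) ^ 2) hR2
  have hMh : 2 ≤ Mh := le_trans (by norm_num) hM8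
  have hsc : 0 ≤ sc hMh1 hP4 c cf := by unfold sc; positivity
  have hC2 := C2F_nonneg d ℓ
  have hterm : 0 ≤ ((((ℓ + 1 : ℕ) : ℝ)) ^ j0 hMh1 hP4 c) ^ 2 * (C2F d ℓ / (8 / 5 * (bigSide ℓ Mh c.1.1 : ℝ)) ^ 2) := by positivity
  have hh := hch_deep1 hN hk hMh1 hP4 hMha c ha hM8 hR2 w cf
  obtain ⟨y, ν⟩ := b
  by_cases hy : y ∈ DeepS (tC hN hk hMh1 hP4 c ha a (wC hN hk c w) cf) (x0 ℓ Mh k c.1) 0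
  · rw [extend_smul_lapTS_apply _ hh y ν hy, tC_j, abs_mul, abs_of_nonneg hsc]
    refine mul_le_mul_of_nonneg_left ?_ hsc
    refine (Finset.abs_sum_le_sum_abs _ _).trans ?_
    have hcard : (Finset.univ : Finset (Fin (d + 1))).card = d + 1 := Finset.card_fin _
    calc ∑ μ : Fin (d + 1), |((((ℓ + 1 : ℕ) : ℝ)) ^ j0 hMh1 hP4 c) ^ 2 *
            (2 * hch hN hMh1 hP4 c ⟨y, ν⟩ - hch hN hMh1 hP4 c ⟨y.unshift μ, ν⟩ - hch hN hMh1 hP4 c ⟨y.shift μ, ν⟩)|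
        ≤ ∑ _μ : Fin (d + 1), ((((ℓ + 1 : ℕ) : ℝ)) ^ j0 hMh1 hP4 c) ^ 2 * (C2F d ℓ / (8 / 5 * (bigSide ℓ Mh c.1.1 : ℝ)) ^ 2) := by
          refine Finset.sum_le_sum fun μ _ => ?_
          have hLj2 : (0 : ℝ) ≤ ((((ℓ + 1 : ℕ) : ℝ)) ^ j0 hMh1 hP4 c) ^ 2 := by positivity
          rw [abs_mul, abs_of_nonneg hLj2]
          refine mul_le_mul_of_nonneg_left ?_ hLj2
          have h2 := abs_hch_second_le hN hMh1 hP4 c hR hP5 hMh y ν μ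
          rw [show 2 * hch hN hMh1 hP4 c ⟨y, ν⟩ - hch hN hMh1 hP4 c ⟨y.unshift μ, ν⟩ - hch hN hMh1 hP4 c ⟨y.shift μ, ν⟩ =
            -(hch hN hMh1 hP4 c ⟨y.shift μ, ν⟩ - 2 * hch hN hMh1 hP4 c ⟨y, ν⟩ + hch hN hMh1 hP4 c ⟨y.unshift μ, ν⟩) by ring, abs_neg]
          exact h2
      _ = ((d : ℝ) + 1) * (((((ℓ + 1 : ℕ) : ℝ)) ^ j0 hMh1 hP4 c) ^ 2 * (C2F d ℓ / (8 / 5 * (bigSide ℓ Mh c.1.1 : ℝ)) ^ 2)) := by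
          rw [Finset.sum_const, hcard, nsmul_eq_mul]; push_cast; ring
  · rw [extend_apply_of_not_mem _ hy, abs_zero]
    positivity

/-- **THE CHART-FRAME SUPPORT OF `c₀`**. [cite: Balaban1984PropagatorsII, p.239/p.247 (supports of h_□, ζ_□ in □̃ — our paraphrase of p.239 «equal to 1 on a cube containing □ … equal to 0 outside a similar cube», not a printed sentence), p.235] -/
theorem blkOf_mem_QT_of_c0C_chart_ne_zero (hM8 : 8 ≤ Mh) (hR2 : 2 * (ℓ + 1) ^ 2 ≤ R) (hP5 : ∀ μ, 5 ≤ P' μ) (hpl : Placed ℓ k P' c.1)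
    (w : BondIdx (domT hN D hk) → ℝ) (cf : ℝ) (b : PBond (PV d ℓ m K hd hL) 0)
    (hb : extendOp (cB (tC hN hk hMh1 hP4 c ha a (wC hN hk c w) cf) (x0 ℓ Mh k c.1) (hx0 hpl) (hfit hN hMh1 hP4 hMha c ha hpl)).W
        (eB (tC hN hk hMh1 hP4 c ha a (wC hN hk c w) cf) (x0 ℓ Mh k c.1))
        (sc hMh1 hP4 c cf • onFun (tC hN hk hMh1 hP4 c ha a (wC hN hk c w) cf).lapTS
          (restrictOp (cB (tC hN hk hMh1 hP4 c ha a (wC hN hk c w) cf) (x0 ℓ Mh k c.1) (hx0 hpl) (hfit hN hMh1 hP4 hMha c ha hpl)).W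
            (eB (tC hN hk hMh1 hP4 c ha a (wC hN hk c w) cf) (x0 ℓ Mh k c.1)) (hch hN hMh1 hP4 c))) b ≠ 0) :
    blkOf D.toDomains (σch D c (toBox hN b.src)) ∈ QT D hMh1 hP4 c := by
  have hR : 2 * (ℓ + 1) ≤ R := le_trans (by nlinarith : 2 * (ℓ + 1) ≤ 2 * (ℓ + 1) ^ 2) hR2
  have hMh : 2 ≤ Mh := le_trans (by norm_num) hM8
  have hh := hch_deep1 hN hk hMh1 hP4 hMha c ha hM8 hR2 w cf
  obtain ⟨y, ν⟩ := b
  by_cases hy : y ∈ DeepS (tC hN hk hMh1 hP4 c ha a (wC hN hk c w) cf) (x0 ℓ Mh k c.1) 0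
  · rw [extend_smul_lapTS_apply _ hh y ν hy] at hb
    -- `h^ch_□(y, ν) ≠ 0`, or some neighbour value is non-zero
    by_cases h0 : hch hN hMh1 hP4 c ⟨y, ν⟩ ≠ 0
    · exact blkOf_σch_mem_QT hN hMh1 hP4 c hM8 hR hP5 y (μ := ν) (Or.inl h0)
    · push Not at h0
      have hsum : ∑ μ : Fin (d + 1), ((((ℓ + 1 : ℕ) : ℝ)) ^ (tC hN hk hMh1 hP4 c ha a (wC hN hk c w) cf).j) ^ 2 *
          (2 * hch hN hMh1 hP4 c ⟨y, ν⟩ - hch hN hMh1 hP4 c ⟨y.unshift μ, ν⟩ - hch hN hMh1 hP4 c ⟨y.shift μ, ν⟩) ≠ 0 := by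
        intro hs; exact hb (by rw [hs, mul_zero])
      obtain ⟨μ, -, hμ⟩ := Finset.exists_ne_zero_of_sum_ne_zero hsum
      have hne : hch hN hMh1 hP4 c ⟨y, ν⟩ ≠ 0 ∨ hch hN hMh1 hP4 c ⟨y.shift μ, ν⟩ ≠ 0 ∨ hch hN hMh1 hP4 c ⟨y.unshift μ, ν⟩ ≠ 0 := by
        by_contra hcon
        push Not at hcon
        obtain ⟨-, h2, h3⟩ := hcon
        exact hμ (by rw [h0, h2, h3]; ring)
      exact blkOf_σch_mem_QT hN hMh1 hP4 c hM8 hR hP5 y hne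
  · exact absurd (extend_apply_of_not_mem _ hy) hb

/-- **`hcfT` FOR THE CUBE**: `c_e(x) ≠ 0 ⟹ y(x₋) ∈ Q^T_□` — the line-1 first-order coefficients of the genuine member live over the reach `□⁺`.
[cite: Balaban1984PropagatorsII, p.239/p.247 (supports of h_□, ζ_□ in □̃ — our paraphrase of p.239 «equal to 1 on a cube containing □ … equal to 0 outside a similar cube», not a printed sentence), (2.92) p.239 (line 1), (2.134) p.247] -/
theorem cfC_supp (hM8 : 8 ≤ Mh) (hR2 : 2 * (ℓ + 1) ^ 2 ≤ R) (hP5 : ∀ μ, 5 ≤ P' μ) (hpl : Placed ℓ k P' c.1)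
    (w : BondIdx (domT hN D hk) → ℝ) (cf : ℝ) (e : Fin (d + 1) × Bool) (x : PBond (PV d ℓ m K hd hL) 0)
    (hx : cfC hN hk hMh1 hP4 hMha c ha hpl w cf e x ≠ 0) : blkV1 hN D x ∈ ST D hMh1 hP4 c := by
  unfold cfC at hx
  rw [trV_apply] at hx
  have key := blkOf_mem_QT_of_cfC_chart_ne_zero hN hk hMh1 hP4 hMha c ha hM8 hR2 hP5 hpl w cf e _ hx
  rw [← blkV1_translate_vch hN c, translate_neg_translate] at key
  exact (mem_ST D hMh1 hP4 c _).2 key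

/-- **`hc₀T` FOR THE CUBE**: `c₀(x) ≠ 0 ⟹ y(x₋) ∈ Q^T_□`. [cite: Balaban1984PropagatorsII, p.239/p.247 (supports of h_□, ζ_□ in □̃ — our paraphrase of p.239 «equal to 1 on a cube containing □ … equal to 0 outside a similar cube», not a printed sentence), (2.92) p.239 (line 1), (2.134) p.247] -/
theorem c0C_supp (hM8 : 8 ≤ Mh) (hR2 : 2 * (ℓ + 1) ^ 2 ≤ R) (hP5 : ∀ μ, 5 ≤ P' μ) (hpl : Placed ℓ k P' c.1)
    (w : BondIdx (domT hN D hk) → ℝ) (cf : ℝ) (x : PBond (PV d ℓ m K hd hL) 0)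
    (hx : c0C hN hk hMh1 hP4 hMha c ha hpl w cf x ≠ 0) : blkV1 hN D x ∈ ST D hMh1 hP4 c := by
  unfold c0C at hx
  rw [trV_apply] at hx
  have key := blkOf_mem_QT_of_c0C_chart_ne_zero hN hk hMh1 hP4 hMha c ha hM8 hR2 hP5 hpl w cf _ hx
  rw [← blkV1_translate_vch hN c, translate_neg_translate] at key
  exact (mem_ST D hMh1 hP4 c _).2 key

/-- the exponent bookkeeping of `hcf`: on a block `y ∈ Q^T_□` (level `j(y) ≤ j + 1`, `j ≤ j₀ + 1`):
`s(□)·L^{j₀}·C1F/(8S/5) ≤ C1F·L³·c′²/(M·len(y)²)` (`M = L·M_h`, `S = M_h L^{j+1}`, `len(y) = L^{j(y)}`, `s(□) = (c′/L^{j₀})²`).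
[cite: Balaban1984PropagatorsII, p.247 («|∂h_□| ≤ O(1)(ML^jη)^{−1}»), (2.94) p.239, bookkeeping] -/
theorem cfC_value_le (hL2 : Odd (ℓ + 1) ∧ 1 < ℓ + 1) (hR2 : 2 * (ℓ + 1) ^ 2 ≤ R) (cf : ℝ) {y : ↥(bset D.toDomains)} (hy : y ∈ QT D hMh1 hP4 c) :
    sc hMh1 hP4 c cf * (((ℓ + 1 : ℕ) : ℝ)) ^ j0 hMh1 hP4 c * (C1F d ℓ / (8 / 5 * (bigSide ℓ Mh c.1.1 : ℝ)))
      ≤ C1F d ℓ * ((ℓ : ℝ) + 1) ^ 3 * cf ^ 2 / ((geomTB D).M * (geomTB D).len y ^ 2) := by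
  have hR : 2 * (ℓ + 1) ≤ R := le_trans (by nlinarith : 2 * (ℓ + 1) ≤ 2 * (ℓ + 1) ^ 2) hR2
  have hjy := level_le_of_mem_QT hMh1 hP4 c hR hy
  have hj0 := j0_le_level hMh1 hP4 c hL2 hR2
  have hC1 := C1F_nonneg d ℓ
  have hMpos : (0 : ℝ) < Mh := by exact_mod_cast hMh1
  have hM0 : (Mh : ℝ) ≠ 0 := hMpos.ne'
  have hL1 : (1 : ℝ) ≤ (ℓ : ℝ) + 1 := by linarith [(Nat.cast_nonneg ℓ : (0 : ℝ) ≤ ℓ)]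
  have hLpos : (0 : ℝ) < (ℓ : ℝ) + 1 := by linarith
  have hL0 : (ℓ : ℝ) + 1 ≠ 0 := hLpos.ne'
  -- both sides are `c′²·C1F ×` a monomial in `L`, `M_h`; normalise and compare the monomials
  have e1 : sc hMh1 hP4 c cf * (((ℓ + 1 : ℕ) : ℝ)) ^ j0 hMh1 hP4 c * (C1F d ℓ / (8 / 5 * (bigSide ℓ Mh c.1.1 : ℝ)))
      = cf ^ 2 * C1F d ℓ * 5 / (8 * (Mh : ℝ) * ((ℓ : ℝ) + 1) ^ (j0 hMh1 hP4 c + c.1.1 + 1)) := by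
    unfold sc bigSide
    push_cast
    field_simp
    ring
  have e2 : C1F d ℓ * ((ℓ : ℝ) + 1) ^ 3 * cf ^ 2 / ((geomTB D).M * (geomTB D).len y ^ 2)
      = cf ^ 2 * C1F d ℓ * ((ℓ : ℝ) + 1) ^ 3 / ((Mh : ℝ) * ((ℓ : ℝ) + 1) ^ (2 * y.1.1 + 1)) := by
    rw [geomTB_M, geomTB_len]
    field_simp
    ring
  rw [e1, e2, div_le_div_iff₀ (by positivity) (by positivity)]
  have hpow : ((ℓ : ℝ) + 1) ^ (2 * y.1.1 + 1) ≤ ((ℓ : ℝ) + 1) ^ (j0 hMh1 hP4 c + c.1.1 + 4) :=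
    pow_le_pow_right₀ hL1 (by omega)
  have hmono : 5 * ((ℓ : ℝ) + 1) ^ (2 * y.1.1 + 1) ≤ 8 * ((ℓ : ℝ) + 1) ^ (j0 hMh1 hP4 c + c.1.1 + 4) := by
    have h0 : 0 ≤ ((ℓ : ℝ) + 1) ^ (j0 hMh1 hP4 c + c.1.1 + 4) := by positivity
    nlinarith
  calc cf ^ 2 * C1F d ℓ * 5 * ((Mh : ℝ) * ((ℓ : ℝ) + 1) ^ (2 * y.1.1 + 1))
      = cf ^ 2 * C1F d ℓ * (Mh : ℝ) * (5 * ((ℓ : ℝ) + 1) ^ (2 * y.1.1 + 1)) := by ring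
    _ ≤ cf ^ 2 * C1F d ℓ * (Mh : ℝ) * (8 * ((ℓ : ℝ) + 1) ^ (j0 hMh1 hP4 c + c.1.1 + 4)) :=
        mul_le_mul_of_nonneg_left hmono (by positivity)
    _ = cf ^ 2 * C1F d ℓ * ((ℓ : ℝ) + 1) ^ 3 * (8 * (Mh : ℝ) * ((ℓ : ℝ) + 1) ^ (j0 hMh1 hP4 c + c.1.1 + 1)) := by ring

/-- the exponent bookkeeping of `hc₀`: on `y ∈ Q^T_□`: `s(□)·(d+1)·L^{2j₀}·C2F/(8S/5)² ≤ (d+1)·C2F·L·c′²/(M·len(y)²)` (`M_h ≥ 1`; the spare factor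
`(L·M_h)⁻¹` of print's `M^{−1}` is given away). [cite: Balaban1984PropagatorsII, p.247 («|Δh_□| ≤ O(1)M^{−1}(L^jη)^{−2}»), (2.94) p.239, bookkeeping] -/
theorem c0C_value_le (hR2 : 2 * (ℓ + 1) ^ 2 ≤ R) (cf : ℝ) {y : ↥(bset D.toDomains)} (hy : y ∈ QT D hMh1 hP4 c) :
    sc hMh1 hP4 c cf * (((d : ℝ) + 1) * (((((ℓ + 1 : ℕ) : ℝ)) ^ j0 hMh1 hP4 c) ^ 2 * (C2F d ℓ / (8 / 5 * (bigSide ℓ Mh c.1.1 : ℝ)) ^ 2)))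
      ≤ ((d : ℝ) + 1) * C2F d ℓ * ((ℓ : ℝ) + 1) * cf ^ 2 / ((geomTB D).M * (geomTB D).len y ^ 2) := by
  have hR : 2 * (ℓ + 1) ≤ R := le_trans (by nlinarith : 2 * (ℓ + 1) ≤ 2 * (ℓ + 1) ^ 2) hR2
  have hjy := level_le_of_mem_QT hMh1 hP4 c hR hy
  have hC2 := C2F_nonneg d ℓ
  have hM1 : (1 : ℝ) ≤ Mh := by exact_mod_cast hMh1
  have hMpos : (0 : ℝ) < Mh := by linarith
  have hM0 : (Mh : ℝ) ≠ 0 := hMpos.ne'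
  have hL1 : (1 : ℝ) ≤ (ℓ : ℝ) + 1 := by linarith [(Nat.cast_nonneg ℓ : (0 : ℝ) ≤ ℓ)]
  have hLpos : (0 : ℝ) < (ℓ : ℝ) + 1 := by linarith
  have hL0 : (ℓ : ℝ) + 1 ≠ 0 := hLpos.ne'
  have e1 : sc hMh1 hP4 c cf * (((d : ℝ) + 1) * (((((ℓ + 1 : ℕ) : ℝ)) ^ j0 hMh1 hP4 c) ^ 2 * (C2F d ℓ / (8 / 5 * (bigSide ℓ Mh c.1.1 : ℝ)) ^ 2)))
      = cf ^ 2 * (((d : ℝ) + 1) * C2F d ℓ) * 25 / (64 * (Mh : ℝ) ^ 2 * ((ℓ : ℝ) + 1) ^ (2 * c.1.1 + 2)) := by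
    unfold sc bigSide
    push_cast
    field_simp
    ring
  have e2 : ((d : ℝ) + 1) * C2F d ℓ * ((ℓ : ℝ) + 1) * cf ^ 2 / ((geomTB D).M * (geomTB D).len y ^ 2)
      = cf ^ 2 * (((d : ℝ) + 1) * C2F d ℓ) / ((Mh : ℝ) * ((ℓ : ℝ) + 1) ^ (2 * y.1.1)) := by
    rw [geomTB_M, geomTB_len]
    field_simp
    ring
  rw [e1, e2, div_le_div_iff₀ (by positivity) (by positivity)]
  have hpow : ((ℓ : ℝ) + 1) ^ (2 * y.1.1) ≤ ((ℓ : ℝ) + 1) ^ (2 * c.1.1 + 2) := pow_le_pow_right₀ hL1 (by omega)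
  have hmono : 25 * ((Mh : ℝ) * ((ℓ : ℝ) + 1) ^ (2 * y.1.1)) ≤ 64 * (Mh : ℝ) ^ 2 * ((ℓ : ℝ) + 1) ^ (2 * c.1.1 + 2) := by
    have h0 : 0 ≤ ((ℓ : ℝ) + 1) ^ (2 * c.1.1 + 2) := by positivity
    have h1 : (Mh : ℝ) ≤ (Mh : ℝ) ^ 2 := by nlinarith
    nlinarith [mul_le_mul_of_nonneg_left hpow hMpos.le, mul_le_mul_of_nonneg_right h1 h0]
  calc cf ^ 2 * (((d : ℝ) + 1) * C2F d ℓ) * 25 * ((Mh : ℝ) * ((ℓ : ℝ) + 1) ^ (2 * y.1.1))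
      = cf ^ 2 * (((d : ℝ) + 1) * C2F d ℓ) * (25 * ((Mh : ℝ) * ((ℓ : ℝ) + 1) ^ (2 * y.1.1))) := by ring
    _ ≤ cf ^ 2 * (((d : ℝ) + 1) * C2F d ℓ) * (64 * (Mh : ℝ) ^ 2 * ((ℓ : ℝ) + 1) ^ (2 * c.1.1 + 2)) :=
        mul_le_mul_of_nonneg_left hmono (by positivity)

/-- **`hcf` FOR THE CUBE — THE SIZE OF `c_e`**: `|c_e(x)| ≤ s₁·c′²/(M·len(y(x))²)` with `s₁ := C1F·L³` (on `d, L` only), for every bond `x` of the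
global torus (`M = L·M_h` of `geomTB D`, `len(y) = L^{j(y)}`) — print's *"|∂h_□| ≤ O(1)(ML^jη)^{−1}"* times the unit `s(□)·L^{j₀}` of the rescaled
`E_e = L^{j₀}(S − 1)`. [cite: Balaban1984PropagatorsII, p.247 («|∂h_□| ≤ O(1)(ML^jη)^{−1}»), (2.92) p.239 (line 1), (2.94) p.239, (2.134) p.247] -/
theorem abs_cfC_le (hM8 : 8 ≤ Mh) (hR2 : 2 * (ℓ + 1) ^ 2 ≤ R) (hP5 : ∀ μ, 5 ≤ P' μ) (hpl : Placed ℓ k P' c.1)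
    (w : BondIdx (domT hN D hk) → ℝ) (cf : ℝ) (e : Fin (d + 1) × Bool) (x : PBond (PV d ℓ m K hd hL) 0) :
    |cfC hN hk hMh1 hP4 hMha c ha hpl w cf e x| ≤ C1F d ℓ * ((ℓ : ℝ) + 1) ^ 3 * cf ^ 2 / ((geomTB D).M * (geomTB D).len (blkV1 hN D x) ^ 2) := by
  by_cases hx : cfC hN hk hMh1 hP4 hMha c ha hpl w cf e x = 0
  · rw [hx, abs_zero, geomTB_M, geomTB_len]
    have hC1 := C1F_nonneg d ℓ
    have hMpos : (0 : ℝ) < Mh := by exact_mod_cast hMh1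
    positivity
  have hy : blkV1 hN D x ∈ QT D hMh1 hP4 c := (mem_ST D hMh1 hP4 c _).1 (cfC_supp hN hk hMh1 hP4 hMha c ha hM8 hR2 hP5 hpl w cf e x hx)
  refine le_trans ?_ (cfC_value_le hMh1 hP4 c hL hR2 cf hy)
  unfold cfC
  rw [trV_apply]
  exact abs_cfC_chart_le hN hk hMh1 hP4 hMha c ha hM8 hR2 hP5 hpl w cf e _

/-- **`hc₀` FOR THE CUBE — THE SIZE OF `c₀`**: `|c₀(x)| ≤ s₂·c′²/(M·len(y(x))²)` with `s₂ := (d+1)·C2F·L` (on `d, L` only) — print's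
*"|Δh_□| ≤ O(1)M^{−1}(L^jη)^{−2}"* times the unit `s(□)·L^{2j₀}` of the rescaled `Δ_□`. [cite: Balaban1984PropagatorsII, p.247 («|Δh_□| ≤ O(1)M^{−1}(L^jη)^{−2}»), (2.92) p.239 (line 1), (2.94) p.239, (2.134) p.247] -/
theorem abs_c0C_le (hM8 : 8 ≤ Mh) (hR2 : 2 * (ℓ + 1) ^ 2 ≤ R) (hP5 : ∀ μ, 5 ≤ P' μ) (hpl : Placed ℓ k P' c.1)
    (w : BondIdx (domT hN D hk) → ℝ) (cf : ℝ) (x : PBond (PV d ℓ m K hd hL) 0) :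
    |c0C hN hk hMh1 hP4 hMha c ha hpl w cf x| ≤
      ((d : ℝ) + 1) * C2F d ℓ * ((ℓ : ℝ) + 1) * cf ^ 2 / ((geomTB D).M * (geomTB D).len (blkV1 hN D x) ^ 2) := by
  by_cases hx : c0C hN hk hMh1 hP4 hMha c ha hpl w cf x = 0
  · rw [hx, abs_zero, geomTB_M, geomTB_len]
    have hC2 := C2F_nonneg d ℓ
    have hMpos : (0 : ℝ) < Mh := by exact_mod_cast hMh1
    positivity
  have hy : blkV1 hN D x ∈ QT D hMh1 hP4 c := (mem_ST D hMh1 hP4 c _).1 (c0C_supp hN hk hMh1 hP4 hMha c ha hM8 hR2 hP5 hpl w cf x hx)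
  refine le_trans ?_ (c0C_value_le hMh1 hP4 c hR2 cf hy)
  unfold c0C
  rw [trV_apply]
  exact abs_c0C_chart_le hN hk hMh1 hP4 hMha c ha hM8 hR2 hP5 hpl w cf _

/-- `s₁ ≥ 0`. [cite: Balaban1984PropagatorsII, p.247, bookkeeping] -/
theorem s1C_nonneg (d ℓ : ℕ) : 0 ≤ C1F d ℓ * ((ℓ : ℝ) + 1) ^ 3 := by
  have := C1F_nonneg d ℓ; positivity

/-- `s₂ ≥ 0`. [cite: Balaban1984PropagatorsII, p.247, bookkeeping] -/
theorem s2C_nonneg (d ℓ : ℕ) : 0 ≤ ((d : ℝ) + 1) * C2F d ℓ * ((ℓ : ℝ) + 1) := by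
  have := C2F_nonneg d ℓ; positivity

end Coeff

end Literature.MathematicalPhysics.QuantumFieldTheory.Balaban1983to89.B6CubeCoeffSizesV1
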